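import Summits.AnomalousDissipation.AnomalousDissipation.Theorems.ScalarAnomalySteadySourceFormal.Negative.ForcedToolkit
import Literature.Analysis.FluidPDE.PassiveScalarFourier
import Literature.Analysis.FunctionSpaces.DuBoisReymondAE
import Literature.Analysis.FunctionSpaces.TorusFourierConvolution

/-!
# Negative knowledge for the crux `ScalarAnomalySteadySourceFormal` (stmt-AnomalousDissipation-0448), V-b:
# Fourier modes of witnesses (forced class) and mean conservation

Certified copy of §7 of the cdisprove work file: `forced_setIntegral_test_mul` (the forced weak
formulation tested with `η(t)g(x)`), `forced_ae_mFourierCoeff_eq` — for every weak solution of the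
crux's class with steady integrable source and integrable datum,
`𝓕θ(t)(k) = 𝓕θ₀(k) + ∫_{(0,t]} (-4π²κ|k|² 𝓕θ(s)(k) - ∑ⱼ 2πi kⱼ 𝓕(θuⱼ)(s)(k) + 𝓕h(k)) ds` a.e. (forced twin
of `IsWeakScalarTransportOn.ae_mFourierCoeff_eq`), and `forced_ae_mFourierCoeff_zero_eq` — mean
conservation.  Entry point of all modal attacks on witnesses; most of the provers' glue
`SourcedScalarWellPosed2D` together with `forced_sub`.  Supports stmt-AnomalousDissipation-0448.
-/

set_option linter.dupNamespace false

noncomputable section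

open scoped BigOperators Topology ENNReal NNReal InnerProductSpace ContDiff
open Filter Set Function MeasureTheory UnitAddTorus Complex

namespace Summit.AnomalousDissipation.AnomalousDissipation.Theorems.ScalarAnomalySteadySourceFormal.Negative

open Literature.Analysis
open Literature.Analysis.FunctionSpaces Literature.Analysis.FunctionSpaces.Torus
open Literature.Analysis.FluidPDE Literature.Analysis.FluidPDE.Torus

variable {d : Type*} [Fintype d]
variable {T κ : ℝ} {u : ℝ → UnitAddTorus d → EuclideanSpace ℝ d} {s : ℝ → UnitAddTorus d → ℝ}
  {θ₀ θ₀' : UnitAddTorus d → ℝ} {θ θ' ψ : ℝ → UnitAddTorus d → ℝ}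

section ForcedModes

variable {hs : UnitAddTorus d → ℝ}

/-- **The forced weak formulation tested with `η(t) g(x)`** (steady source `h`):
`∫_{(0,T)} (η' ∫ θg + η ∫ θ(⟪u,∇g⟫ + κΔg)) + ∫_{(0,T)} η (∫ h g) + η(0) ∫ θ₀ g = 0`. [folklore] -/
theorem forced_setIntegral_test_mul (h : IsWeakScalarTransportForcedOn T κ u (fun _ => hs) θ₀ θ)
    {η : ℝ → ℝ} (hη : ContDiff ℝ ∞ η) (hηc : HasCompactSupport η) (hηT : tsupport η ⊆ Iio T)
    {g : UnitAddTorus d → ℝ} (hg : FunctionSpaces.Torus.IsSmooth g) :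
    (∫ t in Ioo 0 T, ((deriv η t * ∫ x, θ t x * g x) +
      η t * ∫ x, θ t x * (⟪u t x, FunctionSpaces.Torus.gradient g x⟫_ℝ + κ * FunctionSpaces.Torus.laplacian g x))) +
      (∫ t in Ioo 0 T, η t * ∫ x, hs x * g x) + η 0 * ∫ x, θ₀ x * g x = 0 := by
  have hψ := isSpaceTimeTest_mul hη hηc hηT hg
  have hg1 : FunctionSpaces.Torus.IsContDiff 1 g := hg.isContDiff (by simp)
  have key := forced_integral_prod_weak_eq h hψ
  have hpt : ∀ p : ℝ × UnitAddTorus d, θ p.1 p.2 *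
      (FunctionSpaces.Torus.timeDeriv (fun t x => η t * g x) p.1 p.2 +
        ⟪u p.1 p.2, FunctionSpaces.Torus.gradient ((fun t x => η t * g x) p.1) p.2⟫_ℝ +
        κ * FunctionSpaces.Torus.laplacian ((fun t x => η t * g x) p.1) p.2) =
      deriv η p.1 * (θ p.1 p.2 * g p.2) +
        η p.1 * (θ p.1 p.2 * (⟪u p.1 p.2, FunctionSpaces.Torus.gradient g p.2⟫_ℝ + κ * FunctionSpaces.Torus.laplacian g p.2)) := by
    intro p
    rw [timeDeriv_mul, gradient_const_mul hg1, laplacian_const_mul hg, real_inner_smul_right]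
    ring
  set P : Measure (ℝ × UnitAddTorus d) := ((volume : Measure ℝ).restrict (Ioo 0 T)).prod volume with hP
  obtain ⟨Ca, hCa⟩ := (hη.continuous_deriv (by simp)).bounded_above_of_compact_support hηc.deriv
  obtain ⟨Cb, hCb⟩ := hη.continuous.bounded_above_of_compact_support hηc
  set f₁ : ℝ × UnitAddTorus d → ℝ := fun p => deriv η p.1 * (θ p.1 p.2 * g p.2) with hf₁
  set f₂ : ℝ × UnitAddTorus d → ℝ := fun p =>
    η p.1 * (θ p.1 p.2 * (⟪u p.1 p.2, FunctionSpaces.Torus.gradient g p.2⟫_ℝ + κ * FunctionSpaces.Torus.laplacian g p.2)) with hf₂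
  -- integrability of the pieces (as in the unforced proof, from the forced toolkit)
  obtain ⟨Cg, hCg⟩ := FunctionSpaces.Torus.exists_forall_norm_le_of_continuous hg.continuous
  obtain ⟨C₂, hC₂⟩ := FunctionSpaces.Torus.exists_forall_norm_le_of_continuous hg.gradient.continuous
  obtain ⟨C₃, hC₃⟩ := FunctionSpaces.Torus.exists_forall_norm_le_of_continuous hg.laplacian.continuous
  have hI₁ : Integrable (fun p : ℝ × UnitAddTorus d => θ p.1 p.2 * g p.2) P :=
    (forced_integrable_uncurry h).mul_bdd (c := Cg) ((hg.continuous.comp continuous_snd).aestronglyMeasurable)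
      (Eventually.of_forall fun p => hCg p.2)
  have hI₂ : Integrable (fun p : ℝ × UnitAddTorus d =>
      θ p.1 p.2 * (⟪u p.1 p.2, FunctionSpaces.Torus.gradient g p.2⟫_ℝ + κ * FunctionSpaces.Torus.laplacian g p.2)) P := by
    have hm : AEStronglyMeasurable (fun p : ℝ × UnitAddTorus d =>
        θ p.1 p.2 * (⟪u p.1 p.2, FunctionSpaces.Torus.gradient g p.2⟫_ℝ + κ * FunctionSpaces.Torus.laplacian g p.2)) P :=
      (forced_aestronglyMeasurable_uncurry h).mul
        (((forced_aestronglyMeasurable_uncurry_velocity h).inner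
          ((hg.gradient.continuous.comp continuous_snd).aestronglyMeasurable)).add
          ((continuous_const.mul (hg.laplacian.continuous.comp continuous_snd)).aestronglyMeasurable))
    refine Integrable.mono' (g := fun p : ℝ × UnitAddTorus d =>
        C₂ * ‖‖u p.1 p.2‖ * θ p.1 p.2‖ + |κ| * C₃ * ‖uncurry θ p‖)
      (((forced_integrable_norm_velocity_mul h).norm.const_mul C₂).add
        ((forced_integrable_uncurry h).norm.const_mul (|κ| * C₃))) hm (Eventually.of_forall fun p => ?_)
    simp only [uncurry, Real.norm_eq_abs, abs_mul, abs_norm]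
    have h2 : |⟪u p.1 p.2, FunctionSpaces.Torus.gradient g p.2⟫_ℝ| ≤ ‖u p.1 p.2‖ * C₂ :=
      (abs_real_inner_le_norm _ _).trans (mul_le_mul_of_nonneg_left (hC₂ _) (norm_nonneg _))
    have h3 : |κ * FunctionSpaces.Torus.laplacian g p.2| ≤ |κ| * C₃ := by
      rw [abs_mul]
      exact mul_le_mul_of_nonneg_left (by simpa [Real.norm_eq_abs] using hC₃ p.2) (abs_nonneg _)
    calc |θ p.1 p.2| * |⟪u p.1 p.2, FunctionSpaces.Torus.gradient g p.2⟫_ℝ + κ * FunctionSpaces.Torus.laplacian g p.2|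
        ≤ |θ p.1 p.2| * (‖u p.1 p.2‖ * C₂ + |κ| * C₃) :=
          mul_le_mul_of_nonneg_left ((abs_add_le _ _).trans (add_le_add h2 h3)) (abs_nonneg _)
      _ = C₂ * (‖u p.1 p.2‖ * |θ p.1 p.2|) + |κ| * C₃ * |θ p.1 p.2| := by ring
  have hf₁i : Integrable f₁ P :=
    hI₁.bdd_mul ((hη.continuous_deriv (by simp)).comp continuous_fst).aestronglyMeasurable
      (Eventually.of_forall fun p => hCa p.1)
  have hf₂i : Integrable f₂ P :=
    hI₂.bdd_mul (hη.continuous.comp continuous_fst).aestronglyMeasurable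
      (Eventually.of_forall fun p => hCb p.1)
  -- the source term
  have hsrc : (∫ t in Ioo 0 T, ∫ x, (fun (_ : ℝ) => hs) t x * (fun t x => η t * g x) t x) =
      ∫ t in Ioo 0 T, η t * ∫ x, hs x * g x := by
    refine integral_congr_ae (Eventually.of_forall fun t => ?_)
    simp only
    rw [← integral_const_mul]
    exact integral_congr_ae (Eventually.of_forall fun x => by ring)
  have esum : (∫ p, (f₁ p + f₂ p) ∂P) + (∫ t in Ioo 0 T, η t * ∫ x, hs x * g x) + η 0 * ∫ x, θ₀ x * g x = 0 := by
    have e1 : ∫ p, (f₁ p + f₂ p) ∂P = ∫ p, θ p.1 p.2 *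
        (FunctionSpaces.Torus.timeDeriv (fun t x => η t * g x) p.1 p.2 +
          ⟪u p.1 p.2, FunctionSpaces.Torus.gradient ((fun t x => η t * g x) p.1) p.2⟫_ℝ +
          κ * FunctionSpaces.Torus.laplacian ((fun t x => η t * g x) p.1) p.2) ∂P :=
      integral_congr_ae (Eventually.of_forall fun p => (hpt p).symm)
    have e2 : η 0 * ∫ x, θ₀ x * g x = ∫ x, θ₀ x * (fun t x => η t * g x) 0 x := by
      rw [← integral_const_mul]
      exact integral_congr_ae (Eventually.of_forall fun x => by simp only; ring)
    rw [e1, e2, ← hsrc]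
    exact key
  have e₁ : ∫ p, f₁ p ∂P = ∫ t in Ioo 0 T, deriv η t * ∫ x, θ t x * g x := by
    rw [hP, integral_prod _ hf₁i]
    refine integral_congr_ae (Eventually.of_forall fun t => ?_)
    simp only [hf₁]
    exact integral_const_mul _ _
  have e₂ : ∫ p, f₂ p ∂P = ∫ t in Ioo 0 T, η t * ∫ x, θ t x *
      (⟪u t x, FunctionSpaces.Torus.gradient g x⟫_ℝ + κ * FunctionSpaces.Torus.laplacian g x) := by
    rw [hP, integral_prod _ hf₂i]
    refine integral_congr_ae (Eventually.of_forall fun t => ?_)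
    simp only [hf₂]
    exact integral_const_mul _ _
  have ha : Integrable (fun t => deriv η t * ∫ x, θ t x * g x) (volume.restrict (Ioo 0 T)) := by
    refine hf₁i.integral_prod_left.congr (Eventually.of_forall fun t => ?_)
    simp only [hf₁]
    exact integral_const_mul _ _
  have hb : Integrable (fun t => η t * ∫ x, θ t x *
      (⟪u t x, FunctionSpaces.Torus.gradient g x⟫_ℝ + κ * FunctionSpaces.Torus.laplacian g x)) (volume.restrict (Ioo 0 T)) := by
    refine hf₂i.integral_prod_left.congr (Eventually.of_forall fun t => ?_)
    simp only [hf₂]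
    exact integral_const_mul _ _
  rw [integral_add hf₁i hf₂i, e₁, e₂] at esum
  rw [integral_add ha hb]
  exact esum

/-- The Fourier modes `t ↦ 𝓕(θ(t))(k)` of a forced weak solution are integrable on `(0,T)`. [folklore] -/
theorem forced_integrableOn_mFourierCoeff (h : IsWeakScalarTransportForcedOn T κ u s θ₀ θ) (k : d → ℤ) :
    Integrable (fun t => mFourierCoeff (fun x => (θ t x : ℂ)) k) (volume.restrict (Ioo 0 T)) := by
  have e : (fun t => mFourierCoeff (fun x => (θ t x : ℂ)) k) =
      fun t => ∫ x, mFourier (-k) x * (θ t x : ℂ) := by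
    funext t
    rw [FunctionSpaces.Torus.mFourierCoeff_eq_integral_volume]
    rfl
  rw [e]
  have hI : Integrable (fun p : ℝ × UnitAddTorus d => mFourier (-k) p.2 * (θ p.1 p.2 : ℂ))
      (((volume : Measure ℝ).restrict (Ioo 0 T)).prod volume) :=
    (ofRealCLM.integrable_comp (forced_integrable_uncurry h)).bdd_mul (c := 1)
      ((mFourier (-k)).continuous.comp continuous_snd).aestronglyMeasurable
      (Eventually.of_forall fun p => ((mFourier (-k)).norm_coe_le_norm p.2).trans_eq mFourier_norm)
  exact hI.integral_prod_left

/-- Integrability of the coordinate fluxes `θ uⱼ` on `(0,T) × T^d` (forced class). [folklore] -/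
theorem forced_integrable_mul_velocity (h : IsWeakScalarTransportForcedOn T κ u s θ₀ θ) (j : d) :
    Integrable (fun p : ℝ × UnitAddTorus d => θ p.1 p.2 * u p.1 p.2 j)
      (((volume : Measure ℝ).restrict (Ioo 0 T)).prod volume) := by
  have hm : AEStronglyMeasurable (fun p : ℝ × UnitAddTorus d => θ p.1 p.2 * u p.1 p.2 j)
      (((volume : Measure ℝ).restrict (Ioo 0 T)).prod volume) :=
    (forced_aestronglyMeasurable_uncurry h).mul
      ((EuclideanSpace.proj j).continuous.comp_aestronglyMeasurable (forced_aestronglyMeasurable_uncurry_velocity h))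
  refine (forced_integrable_norm_velocity_mul h).norm.mono' hm (Eventually.of_forall fun p => ?_)
  rw [norm_mul, norm_mul, norm_norm, Real.norm_eq_abs, Real.norm_eq_abs, mul_comm]
  exact mul_le_mul_of_nonneg_right (FunctionSpaces.Torus.abs_apply_le_norm (u p.1 p.2) j) (abs_nonneg _)

/-- The flux modes `t ↦ 𝓕(θ(t) uⱼ(t))(k)` are integrable on `(0,T)` (forced class). [folklore] -/
theorem forced_integrableOn_mFourierCoeff_mul_velocity (h : IsWeakScalarTransportForcedOn T κ u s θ₀ θ)
    (k : d → ℤ) (j : d) :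
    Integrable (fun t => mFourierCoeff (fun x => ((θ t x * u t x j : ℝ) : ℂ)) k)
      (volume.restrict (Ioo 0 T)) := by
  have e : (fun t => mFourierCoeff (fun x => ((θ t x * u t x j : ℝ) : ℂ)) k) =
      fun t => ∫ x, mFourier (-k) x * ((θ t x * u t x j : ℝ) : ℂ) := by
    funext t
    rw [FunctionSpaces.Torus.mFourierCoeff_eq_integral_volume]
    rfl
  rw [e]
  have hI : Integrable (fun p : ℝ × UnitAddTorus d => mFourier (-k) p.2 * ((θ p.1 p.2 * u p.1 p.2 j : ℝ) : ℂ))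
      (((volume : Measure ℝ).restrict (Ioo 0 T)).prod volume) :=
    (ofRealCLM.integrable_comp (forced_integrable_mul_velocity h j)).bdd_mul (c := 1)
      ((mFourier (-k)).continuous.comp continuous_snd).aestronglyMeasurable
      (Eventually.of_forall fun p => ((mFourier (-k)).norm_coe_le_norm p.2).trans_eq mFourier_norm)
  exact hI.integral_prod_left

/-- For a.e. `t ∈ (0,T)`: `θ t` and all fluxes `θ t · uⱼ t` are integrable (forced class). [folklore] -/
theorem forced_ae_integrable_slice (h : IsWeakScalarTransportForcedOn T κ u s θ₀ θ) :
    ∀ᵐ t ∂(volume.restrict (Ioo 0 T)),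
      Integrable (θ t) volume ∧ ∀ j, Integrable (fun x => θ t x * u t x j) volume := by
  have hall : ∀ᵐ t ∂(volume.restrict (Ioo 0 T)), ∀ j, Integrable (fun x => θ t x * u t x j) volume :=
    ae_all_iff.2 fun j => (forced_integrable_mul_velocity h j).prod_right_ae
  filter_upwards [forced_ae_memLp_two h, hall] with t ht hj
  exact ⟨ht.integrable one_le_two, hj⟩

/-- **The modewise integral equation for the FORCED equation, tested form** (steady source `h`,
integrable datum): for a.e. `t ∈ (0,T)`,
`Re (z 𝓕θ(t)(k)) = Re (z 𝓕θ₀(k)) + ∫_{(0,t]} Re (z (-4π²κ|k|² 𝓕θ(s)(k) - ∑ⱼ 2πi kⱼ 𝓕(θuⱼ)(s)(k) + 𝓕h(k))) ds`. [folklore] -/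
theorem forced_ae_re_mul_mFourierCoeff_eq (h : IsWeakScalarTransportForcedOn T κ u (fun _ => hs) θ₀ θ)
    (hhs : Integrable hs volume) (hθ₀ : Integrable θ₀ volume) (k : d → ℤ) (z : ℂ) :
    ∀ᵐ t ∂(volume.restrict (Ioo 0 T)),
      (z * mFourierCoeff (fun x => (θ t x : ℂ)) k).re =
        (z * mFourierCoeff (fun x => (θ₀ x : ℂ)) k).re +
        ∫ s in Ioc 0 t, (z * (-(((4 * Real.pi ^ 2 * κ * FunctionSpaces.Torus.freqNormSq k : ℝ)) : ℂ) *
            mFourierCoeff (fun x => (θ s x : ℂ)) k -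
          ∑ j, (2 * Real.pi * I * (k j)) * mFourierCoeff (fun x => ((θ s x * u s x j : ℝ) : ℂ)) k +
            mFourierCoeff (fun x => (hs x : ℂ)) k)).re := by
  classical
  have hAi := forced_integrableOn_mFourierCoeff h k
  have hBi : Integrable (fun s => -(((4 * Real.pi ^ 2 * κ * FunctionSpaces.Torus.freqNormSq k : ℝ)) : ℂ) *
        mFourierCoeff (fun x => (θ s x : ℂ)) k -
      ∑ j, (2 * Real.pi * I * (k j)) * mFourierCoeff (fun x => ((θ s x * u s x j : ℝ) : ℂ)) k +
        mFourierCoeff (fun x => (hs x : ℂ)) k) (volume.restrict (Ioo 0 T)) := by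
    haveI : IsFiniteMeasure ((volume : Measure ℝ).restrict (Ioo 0 T)) := ⟨by
      rw [Measure.restrict_apply_univ]; exact measure_Ioo_lt_top⟩
    exact (((hAi.const_mul _).sub (integrable_finsetSum _ fun j _ =>
      (forced_integrableOn_mFourierCoeff_mul_velocity h k j).const_mul _)).add (integrable_const _))
  refine FunctionSpaces.ae_eq_add_setIntegral_of_forall_test (hAi.const_mul z).re (hBi.const_mul z).re
    fun η hη hηc hηT => ?_
  have key := forced_setIntegral_test_mul h hη hηc hηT (FunctionSpaces.Torus.isSmooth_re_trigPoly {-k} (fun _ => z))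
  rw [integral_mul_re_oneMode hθ₀, integral_mul_re_oneMode hhs] at key
  have hae : ∀ᵐ s ∂(volume.restrict (Ioo 0 T)),
      (deriv η s * ∫ x, θ s x * (FunctionSpaces.Torus.trigPoly {-k} (fun _ => z) x).re) +
        η s * ∫ x, θ s x *
          (⟪u s x, FunctionSpaces.Torus.gradient (fun y : UnitAddTorus d => (FunctionSpaces.Torus.trigPoly {-k} (fun _ => z) y).re) x⟫_ℝ +
            κ * FunctionSpaces.Torus.laplacian (fun y : UnitAddTorus d => (FunctionSpaces.Torus.trigPoly {-k} (fun _ => z) y).re) x) =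
      deriv η s * (z * mFourierCoeff (fun x => (θ s x : ℂ)) k).re +
        η s * (z * (-(((4 * Real.pi ^ 2 * κ * FunctionSpaces.Torus.freqNormSq k : ℝ)) : ℂ) *
            mFourierCoeff (fun x => (θ s x : ℂ)) k -
          ∑ j, (2 * Real.pi * I * (k j)) *
            mFourierCoeff (fun x => ((θ s x * u s x j : ℝ) : ℂ)) k)).re := by
    filter_upwards [forced_ae_integrable_slice h] with s hs'
    rw [integral_mul_re_oneMode hs'.1, IsWeakScalarTransportOn.integral_mul_flux_oneMode hs'.1 hs'.2]
  rw [integral_congr_ae hae] at key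
  -- combine the two time integrals
  have hIa : Integrable (fun s => deriv η s * (z * mFourierCoeff (fun x => (θ s x : ℂ)) k).re +
        η s * (z * (-(((4 * Real.pi ^ 2 * κ * FunctionSpaces.Torus.freqNormSq k : ℝ)) : ℂ) *
            mFourierCoeff (fun x => (θ s x : ℂ)) k -
          ∑ j, (2 * Real.pi * I * (k j)) *
            mFourierCoeff (fun x => ((θ s x * u s x j : ℝ) : ℂ)) k)).re) (volume.restrict (Ioo 0 T)) := by
    obtain ⟨Ca, hCa⟩ := (hη.continuous_deriv (by simp)).bounded_above_of_compact_support hηc.deriv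
    obtain ⟨Cb, hCb⟩ := hη.continuous.bounded_above_of_compact_support hηc
    have h1 : Integrable (fun s => (z * mFourierCoeff (fun x => (θ s x : ℂ)) k).re) (volume.restrict (Ioo 0 T)) :=
      (hAi.const_mul z).re
    have hB0 : Integrable (fun s => (z * (-(((4 * Real.pi ^ 2 * κ * FunctionSpaces.Torus.freqNormSq k : ℝ)) : ℂ) *
            mFourierCoeff (fun x => (θ s x : ℂ)) k -
          ∑ j, (2 * Real.pi * I * (k j)) *
            mFourierCoeff (fun x => ((θ s x * u s x j : ℝ) : ℂ)) k)).re) (volume.restrict (Ioo 0 T)) :=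
      (((hAi.const_mul _).sub (integrable_finsetSum _ fun j _ =>
        (forced_integrableOn_mFourierCoeff_mul_velocity h k j).const_mul _)).const_mul z).re
    exact (h1.bdd_mul ((hη.continuous_deriv (by simp)).aestronglyMeasurable) (Eventually.of_forall hCa)).add
      (hB0.bdd_mul hη.continuous.aestronglyMeasurable (Eventually.of_forall hCb))
  have hIb : Integrable (fun s => η s * (z * mFourierCoeff (fun x => (hs x : ℂ)) k).re) (volume.restrict (Ioo 0 T)) := by
    haveI : IsFiniteMeasure ((volume : Measure ℝ).restrict (Ioo 0 T)) := ⟨by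
      rw [Measure.restrict_apply_univ]; exact measure_Ioo_lt_top⟩
    obtain ⟨Cb, hCb⟩ := hη.continuous.bounded_above_of_compact_support hηc
    exact (integrable_const _).bdd_mul hη.continuous.aestronglyMeasurable (Eventually.of_forall hCb)
  rw [← integral_add hIa hIb] at key
  convert key using 2
  refine integral_congr_ae (Eventually.of_forall fun s => ?_)
  simp only [mul_add, Complex.add_re]
  ring

/-- **The Fourier modes of a weak solution of the FORCED equation** (steady integrable source `h`,
integrable datum): for every `k` and a.e. `t ∈ (0,T)`,
`𝓕θ(t)(k) = 𝓕θ₀(k) + ∫_{(0,t]} (-4π²κ|k|² 𝓕θ(s)(k) - ∑ⱼ 2πi kⱼ 𝓕(θ uⱼ)(s)(k) + 𝓕h(k)) ds`. [folklore] -/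
theorem forced_ae_mFourierCoeff_eq (h : IsWeakScalarTransportForcedOn T κ u (fun _ => hs) θ₀ θ)
    (hhs : Integrable hs volume) (hθ₀ : Integrable θ₀ volume) (k : d → ℤ) :
    ∀ᵐ t ∂(volume.restrict (Ioo 0 T)),
      mFourierCoeff (fun x => (θ t x : ℂ)) k = mFourierCoeff (fun x => (θ₀ x : ℂ)) k +
        ∫ s in Ioc 0 t, (-(((4 * Real.pi ^ 2 * κ * FunctionSpaces.Torus.freqNormSq k : ℝ)) : ℂ) *
            mFourierCoeff (fun x => (θ s x : ℂ)) k -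
          ∑ j, (2 * Real.pi * I * (k j)) * mFourierCoeff (fun x => ((θ s x * u s x j : ℝ) : ℂ)) k +
            mFourierCoeff (fun x => (hs x : ℂ)) k) := by
  classical
  have hBi : Integrable (fun s => -(((4 * Real.pi ^ 2 * κ * FunctionSpaces.Torus.freqNormSq k : ℝ)) : ℂ) *
        mFourierCoeff (fun x => (θ s x : ℂ)) k -
      ∑ j, (2 * Real.pi * I * (k j)) * mFourierCoeff (fun x => ((θ s x * u s x j : ℝ) : ℂ)) k +
        mFourierCoeff (fun x => (hs x : ℂ)) k) (volume.restrict (Ioo 0 T)) := by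
    haveI : IsFiniteMeasure ((volume : Measure ℝ).restrict (Ioo 0 T)) := ⟨by
      rw [Measure.restrict_apply_univ]; exact measure_Ioo_lt_top⟩
    exact ((((forced_integrableOn_mFourierCoeff h k).const_mul _).sub (integrable_finsetSum _ fun j _ =>
      (forced_integrableOn_mFourierCoeff_mul_velocity h k j).const_mul _)).add (integrable_const _))
  filter_upwards [forced_ae_re_mul_mFourierCoeff_eq h hhs hθ₀ k 1, forced_ae_re_mul_mFourierCoeff_eq h hhs hθ₀ k I,
    ae_restrict_mem measurableSet_Ioo] with t h1 hI ht
  have hBt := (show IntegrableOn _ (Ioo 0 T) volume from hBi).mono_set (Ioc_subset_Ioo_right ht.2)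
  simp only [one_mul] at h1
  simp only [I_mul_re] at hI
  rw [integral_neg, ← neg_add, neg_inj] at hI
  apply Complex.ext
  · rw [h1, Complex.add_re, re_integral_eq hBt]
  · rw [hI, Complex.add_im, im_integral_eq hBt]

/-- **MEAN CONSERVATION for witnesses** (the zero mode): for a forced weak solution with steady
integrable mean-zero source and integrable datum, `∫ θ(t) = ∫ θ₀` for a.e. `t ∈ (0,T)`
(in complexified form `𝓕θ(t)(0) = 𝓕θ₀(0)`). [folklore] -/
theorem forced_ae_mFourierCoeff_zero_eq (h : IsWeakScalarTransportForcedOn T κ u (fun _ => hs) θ₀ θ)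
    (hhs : Integrable hs volume) (hmean : HasZeroMean hs) (hθ₀ : Integrable θ₀ volume) :
    ∀ᵐ t ∂(volume.restrict (Ioo 0 T)),
      mFourierCoeff (fun x => (θ t x : ℂ)) 0 = mFourierCoeff (fun x => (θ₀ x : ℂ)) 0 := by
  have h0 : mFourierCoeff (fun x => (hs x : ℂ)) 0 = 0 := by
    rw [FunctionSpaces.Torus.mFourierCoeff_eq_integral_conj_mul]
    simp only [mFourier_zero, ContinuousMap.one_apply, map_one, one_mul]
    rw [integral_complex_ofReal, hmean, Complex.ofReal_zero]
  filter_upwards [forced_ae_mFourierCoeff_eq h hhs hθ₀ 0] with t ht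
  rw [ht, h0]
  simp [FunctionSpaces.Torus.freqNormSq]

end ForcedModes

end Summit.AnomalousDissipation.AnomalousDissipation.Theorems.ScalarAnomalySteadySourceFormal.Negative
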